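import Mathlib
import HarnessLib
import Literature.Analysis.FluidPDE.ClassicalSolution
import Literature.Analysis.FluidPDE.VectorCalculus
import Literature.Analysis.FluidPDE.NSBoundedMildOseen
import Literature.Analysis.UnboundedOperators.HeatKernel

/-!
# Route `UnthreadedRigidityDoor`, item `UnthreadedRigidity` (W2, stmt-NavierStokesRegularity-27585) — LINE g10-2 «PROFILE HORN»
# (planner ns-idea-6 g10; idea-crit-4 g6 PASS 2026-08-29T01:30:55Z): THE TYPED OBJECTS AND STATEMENTS of the line
# (Theorems-side twin of the sketch)

Definition file (Theorems-side twin of the files-only line sketch `pub/ideators/ns-idea-6/lines/UnthreadedRigidityDoor/ProfileHorn_sketch.lean`,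
sha16 916bdf9b3eac7d48, 2026-08-29; namespace `…Theorems.UnthreadedRigidity.ProfileHorn` instead of the sketch's
`…Cruxes.UnthreadedRigidity.ProfileHorn`; every def BODY below is VERBATIM; the sketch's `import …Theses.UnthreadedRigidityDoor` is dropped —
no body here uses a Theses symbol — and `NSBoundedMildOseen` / `HeatKernel` are imported for `oseenDuhamel` / `heatExtension`).  Purpose: kernel
theorems about the line (`nullProfileShellZero`, the compositions `separableShellOrderTwoRigidity_of_horn` / `separableWindowRigidity_of_horn`, and
THEOREM PHR `profileHornRigidity`) can be stated BY NAME from `Theorems/` (same device as `ThreadingFluxHorizonTowerDefs.lean`,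
`UnthreadedDoorNetFluxDefs.lean`).  Filed Theorems-side by the W2 Lean hand ns-crc-p1 g7 (DIRECTOR-NS dss_128 / KEY-NS #184); author of the statements:
planner ns-idea-6 g10.

THE LINE (sketch docstring, abridged).  Datum `u₀ = curl (H(|y|) ∇Y × y)`, `y = x − x₀`, `Y(y) = yᵀQy` (`Q` symmetric traceless), radial profile
`H(r) = h(r²)`.  EXACT IDENTITY (engine-symbolic, kit j321612/j321644; cross-validated j321648):  `c₂(x) = K(r) · D_Q(y) · W̃[H](r)`,
`W̃[H] = 16 α² − 4 e₂ + (16/7) r² e₄`, `α = rH′ + 3H`, `K = H″ + 6H′/r`, `D_Q(y) = det[y, Qy, Q²y]`, `e_L = r b_L′ + L b_L` the Euler derivatives of the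
decaying radial pressure coefficients.  On the separable `l = 2` class «silent at order two» is the HORN EQUATION `K · W̃[H] ≡ 0`; THEOREM PHR says its
only admissible root is `H ≡ 0`.  `sepShell H Q x₀` is, definitionally, `HorizonTower.shellSlice H (quadY Q) x₀` of `ThreadingFluxHorizonTowerDefs.lean`
(the single-degree poloidal shell with radial profile `H` and solid harmonic `Y_Q`).

Objects: `E3`, `threadingFlux`, `IsSliceAxisymmetric`, `IsQuadForm`, `quadY`, `discrCubic`, `IsZonalForm`, `sepShell`, `HornAdmissible`, `vortAmp`,
`strainAmp`, `aTwo`, `aFour`, `innerMoment`, `outerMoment`, `eulerPressure`, `hornBracket`.  Statements: `HornIdentityTwo` (BRIDGE PH, M–L),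
`SeparableOrderOneSilence` (LEMMA SEP, recorded), `ProfileHornRigidity` (THEOREM PHR, proved on paper — Lean target), `ProfileHornRoot` (the DEAD
negative edge), `ZonalSepShellAxisymUniform` (S-Z), `NullProfileShellZero` (S-0), the rungs `SeparableShellOrderTwoRigidity` / `SeparableWindowRigidity`,
and `HornWindowSilence` (BRIDGE PH-W, M–L).

WHAT THIS IS NOT: no NS-regularity statement is touched; `UnthreadedRigidity` (27585), W2 and NS regularity stay OPEN; these are the objects of one
line on the wall item (the conjectural bridges among them are labelled so in their docstrings); nobody here claims `UnthreadedRigidity`.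
`--supports stmt-NavierStokesRegularity-27585 --as helper`.  [cite: MajdaBertozziCUP2002, §1.1 (vector identities); LemarieRieusset2016 (mild
formulation)]
-/

-- the summit and its single sub-problem share the name (CONVENTIONS §1)
set_option linter.dupNamespace false

namespace Summit.NavierStokesRegularity.NavierStokesRegularity.Theorems.UnthreadedRigidity.ProfileHorn

open scoped Topology
open Filter Set MeasureTheory
/-- ℝ³. -/
abbrev E3 : Type := EuclideanSpace ℝ (Fin 3)

/-- Threading flux `F(t,x) = ⟪curl u(t) x, x − x₀⟫` (verbatim g8-2 / g9). -/
noncomputable def threadingFlux (u : ℝ → E3 → E3) (x₀ : E3) (t : ℝ) (x : E3) : ℝ :=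
  inner ℝ (Literature.Analysis.FluidPDE.curl (u t) x) (x - x₀)

/-- Slice axisymmetry about an axis through `x₀` (verbatim g8-2 / g9; the conclusion shape of `UnthreadedRigidity`). -/
def IsSliceAxisymmetric (v : E3 → E3) (x₀ : E3) : Prop :=
  ∃ A : E3 →L[ℝ] E3, (∀ x, inner ℝ (A x) x = 0) ∧ A ≠ 0 ∧ ∀ x, fderiv ℝ v x (A (x - x₀)) - A (v x) = 0

/-! ## The separable `l = 2` shell and its form -/

/-- quadratic forms of `V₂`: symmetric traceless `3 × 3` matrices. -/
def IsQuadForm (Q : Matrix (Fin 3) (Fin 3) ℝ) : Prop := Q.IsSymm ∧ Q.trace = 0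

/-- `Y_Q(y) = yᵀ Q y`. -/
noncomputable def quadY (Q : Matrix (Fin 3) (Fin 3) ℝ) (y : E3) : ℝ := ∑ i, ∑ j, y i * Q i j * y j

/-- the discriminant cubic `D_Q(y) = det[y, Qy, Q²y]` (`= (a−b)(b−c)(c−a)·y₁y₂y₃` in an eigenframe of `Q = diag(a,b,c)`; it spans the unique
`H₃`-channel of the order-two jet — GORDAN PURITY at `l = 2`). -/
noncomputable def discrCubic (Q : Matrix (Fin 3) (Fin 3) ℝ) (y : E3) : ℝ :=
  Matrix.det (Matrix.of ![fun i => y i, Q.mulVec (fun i => y i), (Q * Q).mulVec (fun i => y i)])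

/-- `Y_Q` is ZONAL (a repeated eigenvalue) iff `D_Q` vanishes on the unit sphere. -/
def IsZonalForm (Q : Matrix (Fin 3) (Fin 3) ℝ) : Prop := ∀ y : E3, ‖y‖ = 1 → discrCubic Q y = 0

/-- the separable `l = 2` poloidal shell about `x₀` with radial profile `H` and form `Q`: `u₀ = curl curl (H(|y|) Y_Q(y) · y)`, `y = x − x₀`
(`= curl (H ∇Y × y)`). -/
noncomputable def sepShell (H : ℝ → ℝ) (Q : Matrix (Fin 3) (Fin 3) ℝ) (x₀ : E3) : E3 → E3 :=
  Literature.Analysis.FluidPDE.curl (Literature.Analysis.FluidPDE.curl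
    (fun x : E3 => (H ‖x - x₀‖ * quadY Q (x - x₀)) • (x - x₀)))

/-- ADMISSIBLE radial profiles: `H(r) = h(r²)` with `h` smooth (so the shell is smooth at the apex), and polynomial decay
`r⁵|H|, r⁶|H′|, r⁷|H″| ≤ C` on `[1, ∞)` (covers compact support, the harmonic tails `d·r⁻⁵`, Schwartz profiles; makes every pressure integral below finite). -/
def HornAdmissible (H : ℝ → ℝ) : Prop :=
  (∃ h : ℝ → ℝ, ContDiff ℝ (⊤ : ℕ∞) h ∧ ∀ r, 0 ≤ r → H r = h (r ^ 2)) ∧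
  ∃ C : ℝ, ∀ r, 1 ≤ r → r ^ 5 * |H r| ≤ C ∧ r ^ 6 * |deriv H r| ≤ C ∧ r ^ 7 * |deriv (deriv H) r| ≤ C

/-! ## The horn bracket `W̃[H]` (every constant engine-exact, kit j321612/j321644) -/

/-- vorticity amplitude `K = H″ + 6H′/r` (`curl u₀ = −K · ∇Y × y`). -/
noncomputable def vortAmp (H : ℝ → ℝ) (r : ℝ) : ℝ := deriv (deriv H) r + 6 / r * deriv H r

/-- strain amplitude `α = rH′ + 3H` (`u₀ = α ∇Y − (2H′/r) Y y`). -/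
noncomputable def strainAmp (H : ℝ → ℝ) (r : ℝ) : ℝ := r * deriv H r + 3 * H r

/-- quadrupole channel of the pressure source `σ = ∂ᵢuⱼ∂ⱼuᵢ = a₀ + a₂ S₂ + a₄ S₄` (`S₂ = yᵀ(Q²)₀y`):
`a₂ = −(24/7) r⁻¹ (r²H′H″ − 3rHH″ − 2rH′² − 18HH′)`. -/
noncomputable def aTwo (H : ℝ → ℝ) (r : ℝ) : ℝ :=
  -(24 / (7 * r)) * (r ^ 2 * deriv H r * deriv (deriv H) r - 3 * r * H r * deriv (deriv H) r
    - 2 * r * deriv H r ^ 2 - 18 * H r * deriv H r)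

/-- hexadecapole channel (`S₄ = proj_{H₄}(Y²)`): `a₄ = 8 r⁻³ (r²H′H″ − 3rHH″ + 12rH′² + 3HH′)`. -/
noncomputable def aFour (H : ℝ → ℝ) (r : ℝ) : ℝ :=
  8 / r ^ 3 * (r ^ 2 * deriv H r * deriv (deriv H) r - 3 * r * H r * deriv (deriv H) r
    + 12 * r * deriv H r ^ 2 + 3 * H r * deriv H r)

/-- inner moment `I_L(r) = ∫₀^r ρ^{2L+2} a(ρ) dρ`. -/
noncomputable def innerMoment (a : ℝ → ℝ) (L : ℕ) (r : ℝ) : ℝ := ∫ ρ in (0 : ℝ)..r, ρ ^ (2 * L + 2) * a ρ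

/-- outer moment `J(r) = ∫_r^∞ ρ a(ρ) dρ`. -/
noncomputable def outerMoment (a : ℝ → ℝ) (r : ℝ) : ℝ := ∫ ρ in Set.Ioi r, ρ * a ρ

/-- Euler derivative `e_L = r b_L′ + L b_L` of the decaying solution of `b_L″ + (2L+2) b_L′/r = −a`:
`e_L(r) = −((L+1)/(2L+1)) r^{−(2L+1)} I_L(r) + (L/(2L+1)) J(r)`. -/
noncomputable def eulerPressure (a : ℝ → ℝ) (L : ℕ) (r : ℝ) : ℝ :=
  -(((L : ℝ) + 1) / (2 * L + 1)) * (r ^ (2 * L + 1))⁻¹ * innerMoment a L r + ((L : ℝ) / (2 * L + 1)) * outerMoment a r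

/-- THE HORN BRACKET `W̃[H](r) = 16 α² − 4 e₂ + (16/7) r² e₄`. -/
noncomputable def hornBracket (H : ℝ → ℝ) (r : ℝ) : ℝ :=
  16 * strainAmp H r ^ 2 - 4 * eulerPressure (aTwo H) 2 r + 16 / 7 * r ^ 2 * eulerPressure (aFour H) 4 r

/-! ## Statements -/

/-- BRIDGE PH «PROFILE-HORN IDENTITY» (M–L; exact slice algebra + one-sided smoothness + the decaying pressure gauge): for the classical solution on
`[t₀,T)` with decaying pressure issuing from a separable `l = 2` shell, the one-sided second threading jet at `x₀ + r·y` (`|y| = 1`, `r > 0`) is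
`K(r) · r³ D_Q(y) · W̃[H](r)`.  ENGINE-EXACT for symbolic `H` and symbolic diagonal `Q` (kit j321644: GORDAN PURITY true, structure test true, identical
across forms); Gaussian cross-check vs g9's G-engine rel. diff 9e−17 (kit j321648).  WHY IT MIGHT FAIL: only through the M-part (jets of the solution =
formal jets; uniqueness of the decaying pressure `Δp = −σ`), not through the algebra. -/
def HornIdentityTwo : Prop :=
  ∀ (t₀ T : ℝ) (u : ℝ → E3 → E3) (p : ℝ → E3 → ℝ) (x₀ : E3) (Q : Matrix (Fin 3) (Fin 3) ℝ) (H : ℝ → ℝ),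
    t₀ < T →
    Literature.Analysis.FluidPDE.IsClassicalNSSolutionOn (Set.Ico t₀ T) 1 0 u p →
    (∀ t ∈ Set.Ico t₀ T, Tendsto (p t) (cocompact E3) (𝓝 0)) →
    IsQuadForm Q → HornAdmissible H → u t₀ = sepShell H Q x₀ →
    ∀ r : ℝ, 0 < r → ∀ y : E3, ‖y‖ = 1 →
      iteratedDerivWithin 2 (fun t => threadingFlux u x₀ t (x₀ + r • y)) (Set.Ici t₀) t₀
        = vortAmp H r * r ^ 3 * discrCubic Q y * hornBracket H r

/-- LEMMA SEP at `l = 2` (M; g9's LEMMA SEP specialised, engine-exact): the first one-sided threading jet of a separable shell vanishes. (Recorded; not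
used by the compositions below, which ASSUME nothing about the first jet.) -/
def SeparableOrderOneSilence : Prop :=
  ∀ (t₀ T : ℝ) (u : ℝ → E3 → E3) (p : ℝ → E3 → ℝ) (x₀ : E3) (Q : Matrix (Fin 3) (Fin 3) ℝ) (H : ℝ → ℝ),
    t₀ < T →
    Literature.Analysis.FluidPDE.IsClassicalNSSolutionOn (Set.Ico t₀ T) 1 0 u p →
    IsQuadForm Q → HornAdmissible H → u t₀ = sepShell H Q x₀ →
    ∀ x : E3, derivWithin (fun t => threadingFlux u x₀ t x) (Set.Ici t₀) t₀ = 0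

/-- THEOREM PHR «PROFILE-HORN RIGIDITY» (PROVED ON PAPER, GERMS.md §g10; Lean proof = prover target, size M: two integrations by parts, one
limit `r → r₀⁺`, positivity of `∫ H′²/ρ`): the horn equation `K · W̃[H] ≡ 0` on `(0,∞)` has no admissible root other than `H ≡ 0`.
WHY IT MIGHT FAIL: only if the paper proof has a gap (the finiteness / continuity of the pressure integrals under `HornAdmissible`, the passage to the
limit at the onset radius); the algebraic skeleton (`ρa₂ = −(12/7)G₂′`, `J₄(r₀) = 120∫_{r₀}^∞H′²/ρ`, `108 ≠ 27`) is exact. -/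
def ProfileHornRigidity : Prop :=
  ∀ H : ℝ → ℝ, HornAdmissible H → (∀ r : ℝ, 0 < r → vortAmp H r * hornBracket H r = 0) → ∀ r : ℝ, 0 ≤ r → H r = 0

/-- NEGATIVE HORN (the counterexample this line set out to build; now REFUTED on paper by PHR — kept as the typed negative edge): an admissible
non-trivial root of the horn equation. -/
def ProfileHornRoot : Prop :=
  ∃ H : ℝ → ℝ, HornAdmissible H ∧ (∀ r : ℝ, 0 < r → vortAmp H r * hornBracket H r = 0) ∧ ∃ r : ℝ, 0 ≤ r ∧ H r ≠ 0

/-- S-Z (support, S–M): a zonal form gives an axisymmetric shell, with ONE axis generator serving every profile (rotation about the simple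
eigenvector's axis; `Q = 0` ⇒ any generator). -/
def ZonalSepShellAxisymUniform : Prop :=
  ∀ Q : Matrix (Fin 3) (Fin 3) ℝ, IsQuadForm Q → IsZonalForm Q →
    ∃ A : E3 →L[ℝ] E3, (∀ x, inner ℝ (A x) x = 0) ∧ A ≠ 0 ∧
      ∀ (H : ℝ → ℝ) (x₀ : E3), HornAdmissible H → ∀ x, fderiv ℝ (sepShell H Q x₀) x (A (x - x₀)) - A (sepShell H Q x₀ x) = 0

/-- S-0 (support, S; provable now: `curl` of the zero field is zero): the null profile gives the zero field. -/
def NullProfileShellZero : Prop :=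
  ∀ (H : ℝ → ℝ) (Q : Matrix (Fin 3) (Fin 3) ℝ) (x₀ : E3), (∀ r : ℝ, 0 ≤ r → H r = 0) → ∀ x, sepShell H Q x₀ x = 0

/-- RUNG «SEPARABLE-SHELL ORDER-TWO RIGIDITY at l = 2, ALL PROFILES» (g9's N2 shape with the Gaussian datum replaced by an arbitrary admissible
profile): a separable `l = 2` shell, left-end slice of a classical solution on `[t₀,T)` with decaying pressure, whose threading flux has vanishing
one-sided first and second jets at `t₀`, is an axisymmetric slice. -/
def SeparableShellOrderTwoRigidity : Prop :=
  ∀ (t₀ T : ℝ) (u : ℝ → E3 → E3) (p : ℝ → E3 → ℝ) (x₀ : E3) (Q : Matrix (Fin 3) (Fin 3) ℝ) (H : ℝ → ℝ),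
    t₀ < T →
    Literature.Analysis.FluidPDE.IsClassicalNSSolutionOn (Set.Ico t₀ T) 1 0 u p →
    (∀ t ∈ Set.Ico t₀ T, Tendsto (p t) (cocompact E3) (𝓝 0)) →
    IsQuadForm Q → HornAdmissible H → u t₀ = sepShell H Q x₀ →
    (∀ x : E3, derivWithin (fun t => threadingFlux u x₀ t x) (Set.Ici t₀) t₀ = 0) →
    (∀ x : E3, iteratedDerivWithin 2 (fun t => threadingFlux u x₀ t x) (Set.Ici t₀) t₀ = 0) →
    IsSliceAxisymmetric (u t₀) x₀

/-! ## The window rung: 27585 restricted to separable `l = 2` windows -/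

/-- RUNG «SEPARABLE-WINDOW RIGIDITY at l = 2»: the crux `UnthreadedRigidity` (hypotheses VERBATIM) restricted to windows every slice of which is a
separable `l = 2` shell about `x₀` with a fixed form `Q` and admissible profiles.  (= the `l = 2`, drift-free case of g5's BC5 rung
`StubSingleDegreeWindow`.) -/
def SeparableWindowRigidity : Prop :=
  ∀ (S : Set ℝ), IsOpen S → IsPreconnected S → ∀ (u : ℝ → E3 → E3) (x₀ : E3),
    ContinuousOn (Function.uncurry u) (S ×ˢ Set.univ) →
    (∀ t ∈ S, Literature.Analysis.FluidPDE.VectorCalculus.IsDivFree (u t)) →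
    (∀ s ∈ S, ∀ t ∈ S, s < t → ∀ x, u t x =
        Literature.Analysis.UnboundedOperators.heatExtension (u s) (t - s) x
          - Literature.Analysis.FluidPDE.oseenDuhamel 1 s u u t x) →
    (∀ τ ∈ S, ∃ B : ℝ, ∀ t ∈ S, t ≤ τ → ∀ x, ‖u t x‖ ≤ B) →
    (∀ t ∈ S, ∀ x, inner ℝ (Literature.Analysis.FluidPDE.curl (u t) x) (x - x₀) = 0) →
    ∀ (Q : Matrix (Fin 3) (Fin 3) ℝ), IsQuadForm Q →
    (∀ t ∈ S, ∃ H : ℝ → ℝ, HornAdmissible H ∧ u t = sepShell H Q x₀) →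
    ∃ A : E3 →L[ℝ] E3, (∀ x, inner ℝ (A x) x = 0) ∧ A ≠ 0 ∧
      ∀ t ∈ S, ∀ x, fderiv ℝ (u t) x (A (x - x₀)) - A (u t x) = 0

/-- BRIDGE PH-W «HORN SILENCE IN A WINDOW» (M–L: interior smoothness/analyticity in time of the bounded mild solution on the open window —
`UnthreadedRigidityDoor.windowAnalytic`, proved in the route file — then THEOREM PH at each slice; the threading flux of a poloidal window is ≡ 0, so
its second time derivative vanishes and the identity leaves `K · D_Q · W̃ = 0`): in such a window, at every time, the form is zonal or the profile
solves the horn equation. -/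
def HornWindowSilence : Prop :=
  ∀ (S : Set ℝ), IsOpen S → ∀ (u : ℝ → E3 → E3) (x₀ : E3),
    ContinuousOn (Function.uncurry u) (S ×ˢ Set.univ) →
    (∀ t ∈ S, Literature.Analysis.FluidPDE.VectorCalculus.IsDivFree (u t)) →
    (∀ s ∈ S, ∀ t ∈ S, s < t → ∀ x, u t x =
        Literature.Analysis.UnboundedOperators.heatExtension (u s) (t - s) x
          - Literature.Analysis.FluidPDE.oseenDuhamel 1 s u u t x) →
    (∀ τ ∈ S, ∃ B : ℝ, ∀ t ∈ S, t ≤ τ → ∀ x, ‖u t x‖ ≤ B) →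
    ∀ (Q : Matrix (Fin 3) (Fin 3) ℝ) (H : ℝ → ℝ → ℝ), IsQuadForm Q →
    (∀ t ∈ S, HornAdmissible (H t) ∧ u t = sepShell (H t) Q x₀) →
    ∀ t ∈ S, IsZonalForm Q ∨ ∀ r : ℝ, 0 < r → vortAmp (H t) r * hornBracket (H t) r = 0


end Summit.NavierStokesRegularity.NavierStokesRegularity.Theorems.UnthreadedRigidity.ProfileHorn
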